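import Literature.NumberTheory.Automorphic.RankinSelbergTorusPositivity
import Literature.NumberTheory.Automorphic.ReductionTheoryGLnMinkowski
import Literature.NumberTheory.Automorphic.IwasawaDecompositionAdelic
import Literature.NumberTheory.Automorphic.UnipotentConjHaarChar
import Literature.NumberTheory.Automorphic.LocalComponentGeneric
import Literature.NumberTheory.Automorphic.AddCharConductorExponent
import Literature.NumberTheory.Automorphic.SummableNormSqTraceSatakePowTorus
import Literature.NumberTheory.GaloisRepresentations.UnitIdeles
import HarnessLib

/-!
# The unramified Rankin–Selberg torus sum at a single good place: Jacquet–Shalika's (5.3.3)–(5.3.4)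
off an arbitrary set of places, from genericity and the finiteness of the unfolded integral

Topic `NumberTheory/Automorphic`; namespace `Literature.NumberTheory.Automorphic`. Proof file
(theorems only: no definition, no named fact), on top of `RankinSelbergTorusIntegral` (the unfolded
global Rankin–Selberg integral `Ψ(σ; W, W̄, Φ)` at a real point in torus coordinates, its Euler lower
bound `(∏_{v ∈ F} T_v(q_v^{-σ})) · c ≤ Ψ(σ)` by positivity, and the torus data
`IsTorusUnramifiedAt` of the Whittaker coefficients of smoothed cusp forms).

The named fact `summable_normSq_trace_satakePow` of `AutomorphicLFunctionProofs` (Jacquet–Shalika,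
*On Euler products and the classification of automorphic representations I*, Amer. J. Math. **103**
(1981), Thm. (5.3), proof, (5.3.3)–(5.3.4) p. 556: `∑_{v ∉ S} ∑_k |tr A_v^k|² k⁻¹ q_v^{-kσ} < ∞` for
`σ > 1`) is stated in the tree off an **arbitrary** set `S`; by
`summable_normSq_trace_satakePow_iff_schurSelfSum_prod_bounded_and_ne_top`
(`SummableNormSqTraceSatakePowTorus`) it is the conjunction of the printed large-finite-`S` statement
(`JacquetShalika1981_schurSelfSum_prod_bounded`) and of the finiteness `T_v(q_v^{-σ}) < ∞` of the
unramified Rankin–Selberg torus sum `T_v(t) = ∑_λ |s_λ(x_v)|² t^{|λ|}` at **every single** place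
`v ∉ S` — the global form of the bound (5.1.3) on the Satake parameters. This file runs the
real-point Rankin–Selberg method at a single place and reduces both halves to the two analytic
inputs of Jacquet–Shalika's §4, kept as explicit hypotheses in their natural form (Tate's character,
Tate's box, any Haar measures):

* (hZ) **genericity** — a non-zero smoothed cuspidal vector `S_η f` has a non-zero global Whittaker
  coefficient `W_φ`, `φ = invQuot (S_η f)` (Shalika (1974), Piatetski-Shapiro; Cogdell (2004),
  Thm. 1.1 and its corollary "cusp forms are generic");
* (hfin) **finiteness of the unfolded integral** — `Ψ(σ; W_φ, W̄_φ, Φ_∞ ⊗ 𝟙_{𝒪̂ⁿ}) < ∞` for `σ > 1`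
  (Jacquet–Shalika (1981), §4; Cogdell (2004), §2.3: `∫ |φ|² E(·, Φ; σ)` converges absolutely for
  `σ > 1`, and unfolding).

## Main results

* `schurSelfSum_ne_top_of_rankinSelberg` — **(hZ) ∧ (hfin at `σ`) ⇒ `T_v(q_v^{-σ}) < ∞` at every
  `v ∉ S`** for every Satake family of a cuspidal `Π` off an arbitrary `S`;
* `jacquetShalika1981_schurSelfSum_prod_bounded_of_rankinSelberg` — **(hZ) ∧ (hfin for `σ > 1`) ⇒
  `JacquetShalika1981_schurSelfSum_prod_bounded`** (the printed (5.3.3)–(5.3.4), large finite `S`);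
* `summable_normSq_trace_satakePow_of_rankinSelberg`, `norm_satakeParameter_le_sqrt_of_rankinSelberg` —
  hence the named facts `summable_normSq_trace_satakePow` and `norm_satakeParameter_le_sqrt` (5.1.3)
  from (hZ) and (hfin).

## The single-place run (proof of `schurSelfSum_ne_top_of_rankinSelberg`)

By `IsSatakeFamilyOf`, `Π` has at `v ∉ S` a non-zero `K(𝔫₀)`-fixed Hecke eigenvector `f` with
`v ∤ 𝔫₀`; smooth it to `φ = invQuot (S_η f)` (`exists_weight_smoothedVector_ne_zero`). The printed
Euler factor `Ψ_v = T_v(q_v^{-s})` needs an additive character of conductor `𝒪_v` at `v`; Tate's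
character `ψ` is ramified above the different, so we pass to a dilate `aψ = ψ(a ·)`, `a ∈ Kˣ`, of
conductor `𝒪_v` at `v` (`IsGlobalAddChar.exists_mulShift_adicComponent_hasConductorExp_zero` of
`AddCharConductorExponent`) and prove the **transport identity**
`W^{aψ}_φ(g) = W^{ψ}_φ(d_a g)`, `d_a = diag(a^{n-1}, …, a, 1) ∈ GL_n(K)` (`whittakerCoeff_mulShift`:
the substitution `u ↦ d_a u d_a⁻¹` in the compact unipotent integral, `ψ_N(d_a u d_a⁻¹) = (aψ)_N(u)`,
the constant by which this automorphism multiplies the Haar measure of `N_n(𝔸_K)`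
(`UnipotentConjHaarChar`) cancelling against the normalisation, and the image of the fundamental
domain being again one). It transports (hZ) to `aψ`, and also (hfin):
`Ψ(σ; W^{aψ}) = Ψ(σ; W^{ψ})` (`rankinSelbergTorusIntegral_eq_of_apply_glDiagonal_pow_mul`: the last
entry of `d_a` is `1`, `|det d_a| δ_B(d_a)⁻¹ = 1` by the product formula, and the torus Haar measure is
invariant). Now `W = W^{aψ}_φ` is an unramified torus datum at `v`
(`exists_isTorusUnramifiedAt_whittakerCoeff_smoothedForm`). A point `g₁` with `W(g₁) ≠ 0` gives, by
Iwasawa `g₁ = u diag(a₁) k₁` and `|W(u g)| = |W(g)|`, a torus point with `W(diag(a₁) k₁) ≠ 0`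
(`exists_torusPoint_apply_ne_zero` of `RankinSelbergTorusPositivity`); multiplying by a rational scalar `t · 1_n` (which fixes `W`,
`whittakerCoeff_glDiagonal_principalIdele_mul`) clears the denominators of `a₁`
(`exists_principalIdele_mul_valued_snd_le_one`), and Shintani's relations strip the `v`-part
`ϖ_v^m` of the now integral `a₁` (`IsTorusUnramifiedAt.exists_apply_torusPoint_ne_zero_valued_eq_one`):
there results a torus point in the unit box at `v`, integral at every finite place, at which `W`
does not vanish. On the open set of integral torus elements the Rankin–Selberg integrand is the
continuous function `|W|² Φ_∞ |det|^σ δ_B⁻¹`, so the unit-box integral is positive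
(`setLIntegral_torusIntegrand_unitBox_ne_zero` of `RankinSelbergTorusPositivity`), and the
Euler lower bound `T_v(q_v^{-σ}) · c ≤ Ψ(σ) < ∞` (`exists_prod_schurSelfSum_le_of_cuspidal` with
`Good = {v}`) gives `T_v(q_v^{-σ}) < ∞`.

For (J) (`jacquetShalika1981_schurSelfSum_prod_bounded_of_rankinSelberg`) no dilation and no
stripping are needed: with Tate's `ψ` and an integral torus point `diag(a₂) k₁` of non-vanishing, take
`S₀ = supp 𝔫₀ ∪ {ψ_v ramified} ∪ {v : a₂ not a unit at v}` and `Good = Sᶜ` for `S ⊇ S₀`.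

## References

* H. Jacquet, J. A. Shalika, *On Euler products and the classification of automorphic
  representations I*, Amer. J. Math. 103 (1981), 499–558: §2 Prop. (2.3); §4; (5.1.3) p. 554;
  Lemma (5.2) p. 554; Thm. (5.3) p. 555, proof (5.3.3)–(5.3.4) p. 556 [JacquetShalikaAJM1981].
* J. W. Cogdell, *Analytic theory of L-functions for GL_n*, in: J. Bernstein, S. Gelbart (eds.),
  *An Introduction to the Langlands Program* (2004), §1.1 (Thm. 1.1), §2.3 (Thm. 2.2)
  [CogdellAnalyticTheory2004].
* T. Shintani, *On an explicit formula for class-1 Whittaker functions on `GL_n` over `P`-adic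
  fields*, Proc. Japan Acad. 52 (1976) [Shintani1976].
-/

noncomputable section

open MeasureTheory Measure NumberField IsDedekindDomain Matrix Set Filter Finset
open scoped MatrixGroups ENNReal NNReal ComplexConjugate Pointwise
open Literature.RingTheory.SymmetricFunctions.SymmPoly
open Literature.NumberTheory.GaloisRepresentations (ideleGroup localUnits principalIdele)

namespace Literature.NumberTheory.Automorphic

/-! ### Openness of integrality and unit conditions on ideles -/

section Open

variable {K : Type} [Field K] [NumberField K]

/-- The finite component `x_w` of an idele is non-zero. [folklore] -/
theorem valued_snd_ne_zero (x : ideleGroup K) (w : HeightOneSpectrum (𝓞 K)) :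
    Valued.v ((x : AdeleRing (𝓞 K) K).2 w) ≠ 0 := by
  have hu : IsUnit ((x : AdeleRing (𝓞 K) K).2 w) := by
    have := (x.isUnit.map (RingHom.snd (InfiniteAdeleRing K) (FiniteAdeleRing (𝓞 K) K)))
    exact (FiniteAdeleRing.isUnit_iff.1 this).1 w |>.isUnit
  exact (Valuation.ne_zero_iff _).2 hu.ne_zero

/-- **Integrality at a set of places is an open condition on ideles**: for every set `G` of finite
places, `{x ∈ 𝔸_Kˣ : |x_w|_w ≤ 1 ∀ w ∈ G}` is open (the integral adeles `∏_w 𝒪_w` form an open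
subring of the finite adeles). [folklore] -/
theorem isOpen_setOf_forall_valued_snd_le_one (G : Set (HeightOneSpectrum (𝓞 K))) :
    IsOpen {x : ideleGroup K | ∀ w ∈ G, Valued.v ((x : AdeleRing (𝓞 K) K).2 w) ≤ 1} := by
  have hO : IsOpen {f : FiniteAdeleRing (𝓞 K) K |
      ∀ w, w ∈ G → f w ∈ w.adicCompletionIntegers K} :=
    RestrictedProduct.isOpen_forall_imp_mem fun w => Valued.isOpen_valuationSubring _
  have h1 : Continuous fun x : ideleGroup K => (x : AdeleRing (𝓞 K) K).2 :=
    continuous_snd.comp Units.continuous_val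
  have heq : {x : ideleGroup K | ∀ w ∈ G, Valued.v ((x : AdeleRing (𝓞 K) K).2 w) ≤ 1} =
      (fun x : ideleGroup K => (x : AdeleRing (𝓞 K) K).2) ⁻¹'
        {f : FiniteAdeleRing (𝓞 K) K | ∀ w, w ∈ G → f w ∈ w.adicCompletionIntegers K} := by
    ext x
    simp only [Set.mem_setOf_eq, Set.mem_preimage, HeightOneSpectrum.mem_adicCompletionIntegers]
  rw [heq]
  exact hO.preimage h1

/-- **Being a unit at a set of places is an open condition on ideles**: for every set `G` of
finite places, `{x ∈ 𝔸_Kˣ : |x_w|_w = 1 ∀ w ∈ G}` is open in the idele topology (integrality of `x`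
and of `x⁻¹` at the places of `G`). [folklore] -/
theorem isOpen_setOf_forall_valued_snd_eq_one (G : Set (HeightOneSpectrum (𝓞 K))) :
    IsOpen {x : ideleGroup K | ∀ w ∈ G, Valued.v ((x : AdeleRing (𝓞 K) K).2 w) = 1} := by
  have heq : {x : ideleGroup K | ∀ w ∈ G, Valued.v ((x : AdeleRing (𝓞 K) K).2 w) = 1} =
      {x : ideleGroup K | ∀ w ∈ G, Valued.v ((x : AdeleRing (𝓞 K) K).2 w) ≤ 1} ∩
        (fun x : ideleGroup K => x⁻¹) ⁻¹'
          {x : ideleGroup K | ∀ w ∈ G, Valued.v ((x : AdeleRing (𝓞 K) K).2 w) ≤ 1} := by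
    ext x
    simp only [Set.mem_setOf_eq, Set.mem_inter_iff, Set.mem_preimage,
      GaloisRepresentations.ideleGroup_val_inv_snd, map_inv₀]
    constructor
    · intro h
      exact ⟨fun w hw => (h w hw).le, fun w hw => by rw [h w hw, inv_one]⟩
    · rintro ⟨h1, h2⟩ w hw
      refine le_antisymm (h1 w hw) ?_
      have := h2 w hw
      rwa [inv_le_one₀ (zero_lt_iff.2 (valued_snd_ne_zero x w))] at this
  rw [heq]
  exact (isOpen_setOf_forall_valued_snd_le_one G).inter
    ((isOpen_setOf_forall_valued_snd_le_one G).preimage continuous_inv)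

/-- **The unit box is open** in the torus `(𝔸_Kˣ)ⁿ`. [folklore] -/
theorem isOpen_unitBox {n : ℕ} (G : Set (HeightOneSpectrum (𝓞 K))) :
    IsOpen (unitBox (n := n) (K := K) G) := by
  have h : unitBox (n := n) (K := K) G = ⋂ i : Fin n, (fun a : Fin n → ideleGroup K => a i) ⁻¹'
      {x : ideleGroup K | ∀ w ∈ G, Valued.v ((x : AdeleRing (𝓞 K) K).2 w) = 1} := by
    ext a
    simp only [unitBox, Set.mem_setOf_eq, Set.mem_iInter, Set.mem_preimage]
    exact ⟨fun h i w hw => h w hw i, fun h w hw i => h i w hw⟩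
  rw [h]
  exact isOpen_iInter_of_finite fun i =>
    (isOpen_setOf_forall_valued_snd_eq_one G).preimage (continuous_apply i)

/-- The box of torus elements all of whose entries are integral at every finite place is open.
[folklore] -/
theorem isOpen_setOf_forall_forall_valued_snd_le_one {n : ℕ} :
    IsOpen {a : Fin n → ideleGroup K | ∀ i w, Valued.v (((a i : ideleGroup K) : AdeleRing (𝓞 K) K).2 w) ≤ 1} := by
  have h : {a : Fin n → ideleGroup K | ∀ i w, Valued.v (((a i : ideleGroup K) : AdeleRing (𝓞 K) K).2 w) ≤ 1} =
      ⋂ i : Fin n, (fun a : Fin n → ideleGroup K => a i) ⁻¹'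
        {x : ideleGroup K | ∀ w ∈ (Set.univ : Set (HeightOneSpectrum (𝓞 K))),
          Valued.v ((x : AdeleRing (𝓞 K) K).2 w) ≤ 1} := by
    ext a
    simp only [Set.mem_setOf_eq, Set.mem_iInter, Set.mem_preimage, Set.mem_univ, true_implies]
  rw [h]
  exact isOpen_iInter_of_finite fun i =>
    (isOpen_setOf_forall_valued_snd_le_one Set.univ).preimage (continuous_apply i)

end Open

/-! ### Clearing denominators of ideles by a global integer -/

section Denominators

variable {K : Type} [Field K] [NumberField K]

/-- The finite components of `(t) · y` for a principal idele `(t)`, `t ∈ Kˣ`. [folklore] -/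
theorem valued_snd_principalIdele_mul (t : Kˣ) (y : ideleGroup K) (w : HeightOneSpectrum (𝓞 K)) :
    Valued.v (((principalIdele K t * y : ideleGroup K) : AdeleRing (𝓞 K) K).2 w) =
      Valued.v (algebraMap K (w.adicCompletion K) t) * Valued.v ((y : AdeleRing (𝓞 K) K).2 w) := by
  rw [GaloisRepresentations.ideleGroup_val_snd_mul, map_mul]
  congr 2

/-- **Clearing the denominators of finitely many ideles at once**: for a finite family `a` of
ideles there is `t ∈ Kˣ`, integral at every finite place, such that all `t · a_i` are integral at
every finite place. [folklore] -/
theorem exists_principalIdele_mul_valued_snd_le_one {ι : Type*} [Fintype ι] (a : ι → ideleGroup K) :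
    ∃ t : Kˣ, (∀ w : HeightOneSpectrum (𝓞 K), Valued.v (algebraMap K (w.adicCompletion K) t) ≤ 1) ∧
      ∀ i w, Valued.v (((principalIdele K t * a i : ideleGroup K) : AdeleRing (𝓞 K) K).2 w) ≤ 1 := by
  classical
  -- clearing the denominators of each `a i` by a non-zero global integer:
  -- `exists_ne_zero_valued_algebraMap_mul_le_one` (`RankinSelbergTorusPositivity`), read componentwise
  choose t ht0 ht using fun i =>
    show ∃ t : 𝓞 K, t ≠ 0 ∧ ∀ w : HeightOneSpectrum (𝓞 K),
        Valued.v (algebraMap K (w.adicCompletion K) (algebraMap (𝓞 K) K t) *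
          ((a i : ideleGroup K) : AdeleRing (𝓞 K) K).2 w) ≤ 1 from
      exists_ne_zero_valued_algebraMap_mul_le_one (a i)
  have hprod0 : (∏ i, t i) ≠ 0 := Finset.prod_ne_zero_iff.2 fun i _ => ht0 i
  have hK0 : algebraMap (𝓞 K) K (∏ i, t i) ≠ 0 :=
    (map_ne_zero_iff _ (FaithfulSMul.algebraMap_injective (𝓞 K) K)).2 hprod0
  refine ⟨Units.mk0 _ hK0, fun w => ?_, fun i w => ?_⟩
  · rw [Units.val_mk0, GaloisRepresentations.valued_algebraMap_adicCompletion,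
      HeightOneSpectrum.valuation_of_algebraMap]
    exact HeightOneSpectrum.intValuation_le_one _ _
  · rw [valued_snd_principalIdele_mul, Units.val_mk0, ← Finset.mul_prod_erase _ _ (Finset.mem_univ i),
      map_mul, map_mul, map_mul, mul_comm (Valued.v _) (Valued.v _), mul_assoc]
    refine mul_le_one' ?_ (by simpa only [map_mul] using ht i w)
    rw [GaloisRepresentations.valued_algebraMap_adicCompletion, HeightOneSpectrum.valuation_of_algebraMap]
    exact HeightOneSpectrum.intValuation_le_one _ _

end Denominators

/-! ### Rational scalar matrices: centrality and invariance of Whittaker coefficients -/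

section Central

variable {n : ℕ} {K : Type} [Field K] [NumberField K]

/-- A scalar matrix of principal ideles `t · 1_n`, `t ∈ Kˣ`, is a rational point of `GL_n(𝔸_K)`.
[folklore] -/
theorem glDiagonal_const_principalIdele_mem_arithmeticSubgroup (t : Kˣ) :
    glDiagonal n (AdeleRing (𝓞 K) K) (fun _ => principalIdele K t) ∈
      (AdelicGroupData.gl n K).arithmeticSubgroup :=
  glDiagonal_principalIdele_mem_rationalPointsGL n K fun _ => t

/-- **Scaling the torus coordinate by a principal idele is left multiplication by a rational
scalar matrix**: `diag(t a) k = (t · 1_n) · diag(a) k`. [folklore] -/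
theorem torusPoint_principalIdele_mul (t : Kˣ) (a : Fin n → ideleGroup K)
    (k : ↥(maximalCompactAdelic n K)) :
    torusPoint n K ((fun i => principalIdele K t * a i), k) =
      glDiagonal n (AdeleRing (𝓞 K) K) (fun _ => principalIdele K t) * torusPoint n K (a, k) := by
  simp only [torusPoint]
  rw [← mul_assoc, ← map_mul]
  rfl

variable [MeasurableSpace ↥(adelicUnipotent n K)]

/-- **Whittaker coefficients are invariant under rational central elements**: for `φ` left
`GL_n(K)`-invariant and `z ∈ Z(GL_n(𝔸_K)) ∩ GL_n(K)`, `W_φ(z g) = W_φ(g)` (`u z g = z u g` for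
`u ∈ N_n(𝔸_K)`, and `φ(z h) = φ(h)`); no measure-theoretic hypothesis is needed. [folklore] -/
theorem whittakerCoeff_center_mul (ν : Measure ↥(adelicUnipotent n K)) (𝓕 : Set ↥(adelicUnipotent n K))
    (ψ : AddChar (AdeleRing (𝓞 K) K) Circle) {φ : GL (Fin n) (AdeleRing (𝓞 K) K) → ℂ}
    (hφ : IsLeftInvariant (AdelicGroupData.gl n K) φ) {z : GL (Fin n) (AdeleRing (𝓞 K) K)}
    (hz : z ∈ Subgroup.center (GL (Fin n) (AdeleRing (𝓞 K) K)))
    (hzr : z ∈ (AdelicGroupData.gl n K).arithmeticSubgroup) (g : GL (Fin n) (AdeleRing (𝓞 K) K)) :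
    whittakerCoeff ν 𝓕 ψ φ (z * g) = whittakerCoeff ν 𝓕 ψ φ g := by
  simp only [whittakerCoeff_def]
  congr 1
  refine integral_congr_ae (ae_of_all _ fun u => ?_)
  simp only
  rw [← mul_assoc, (Subgroup.mem_center_iff.1 hz (u : GL (Fin n) (AdeleRing (𝓞 K) K))), mul_assoc]
  exact congrArg (fun c => c * (starRingEnd ℂ) (whittakerCharFun ψ u))
    (hφ z hzr ((u : GL (Fin n) (AdeleRing (𝓞 K) K)) * g))

/-- In particular `W_φ((t · 1_n) g) = W_φ(g)` for `t ∈ Kˣ`. [folklore] -/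
theorem whittakerCoeff_glDiagonal_principalIdele_mul (ν : Measure ↥(adelicUnipotent n K))
    (𝓕 : Set ↥(adelicUnipotent n K)) (ψ : AddChar (AdeleRing (𝓞 K) K) Circle)
    {φ : GL (Fin n) (AdeleRing (𝓞 K) K) → ℂ} (hφ : IsLeftInvariant (AdelicGroupData.gl n K) φ)
    (t : Kˣ) (g : GL (Fin n) (AdeleRing (𝓞 K) K)) :
    whittakerCoeff ν 𝓕 ψ φ (glDiagonal n (AdeleRing (𝓞 K) K) (fun _ => principalIdele K t) * g) =
      whittakerCoeff ν 𝓕 ψ φ g :=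
  whittakerCoeff_center_mul ν 𝓕 ψ hφ (glDiagonal_const_mem_center n _)
    (glDiagonal_const_principalIdele_mem_arithmeticSubgroup t) g

end Central

/-! ### Dilating the additive character: `W^{ψ(a·)}(g) = W^{ψ}(d_a g)` -/

section Transport

variable {n : ℕ} {K : Type} [Field K] [NumberField K]

/-- Conjugating a rational unipotent element by a diagonal matrix of principal ideles gives a
rational unipotent element. [folklore] -/
theorem unipotentDiagConj_principalIdele_mem_rationalUnipotent (c : Fin n → Kˣ)
    {γ : ↥(adelicUnipotent n K)} (hγ : γ ∈ rationalUnipotent n K) :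
    unipotentDiagConj (fun i => principalIdele K (c i)) γ ∈ rationalUnipotent n K := by
  obtain ⟨γ₀, hγ₀⟩ := (mem_rationalUnipotent_iff γ).1 hγ
  obtain ⟨D₀, hD₀⟩ := glDiagonal_principalIdele_mem_rationalPointsGL n K c
  rw [mem_rationalUnipotent_iff]
  refine ⟨D₀ * γ₀ * D₀⁻¹, ?_⟩
  rw [map_mul, map_mul, map_inv, hD₀, hγ₀, coe_unipotentDiagConj]

/-- **The superdiagonal of `d_a u d_a⁻¹`** for the dilation matrix
`d_a = diag(a^{n-1}, …, a, 1)`: `∑_i (d_a u d_a⁻¹)_{i,i+1} = a · ∑_i u_{i,i+1}`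
(`(d_a)_i / (d_a)_{i+1} = a`). [folklore] -/
theorem superdiagSum_unipotentDiagConj_pow (a : Kˣ) (u : ↥(adelicUnipotent n K)) :
    superdiagSum (unipotentDiagConj (fun i : Fin n => principalIdele K (a ^ (n - 1 - (i : ℕ)))) u) =
      algebraMap K (AdeleRing (𝓞 K) K) a * superdiagSum u := by
  rw [superdiagSum_def, superdiagSum_def, Finset.mul_sum]
  refine Finset.sum_congr rfl fun i _ => ?_
  rw [Finset.mul_sum]
  refine Finset.sum_congr rfl fun j _ => ?_
  split_ifs with hij
  · rw [coe_unipotentDiagConj, coe_glDiagonal_mul_mul_glDiagonal_inv_apply]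
    have hexp : n - 1 - (i : ℕ) = (n - 1 - (j : ℕ)) + 1 := by have := j.2; omega
    rw [hexp, pow_succ, map_mul]
    have hval : ((principalIdele K a : ideleGroup K) : AdeleRing (𝓞 K) K) =
        algebraMap K (AdeleRing (𝓞 K) K) a := rfl
    calc (((principalIdele K (a ^ (n - 1 - (j : ℕ))) * principalIdele K a : ideleGroup K) :
            AdeleRing (𝓞 K) K)) *
          (((u : GL (Fin n) (AdeleRing (𝓞 K) K)) : Matrix (Fin n) (Fin n) (AdeleRing (𝓞 K) K)) i j) *
          (((principalIdele K (a ^ (n - 1 - (j : ℕ))))⁻¹ : ideleGroup K) : AdeleRing (𝓞 K) K)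
        = ((principalIdele K a : ideleGroup K) : AdeleRing (𝓞 K) K) *
            (((u : GL (Fin n) (AdeleRing (𝓞 K) K)) : Matrix (Fin n) (Fin n) (AdeleRing (𝓞 K) K)) i j) *
            (((principalIdele K (a ^ (n - 1 - (j : ℕ))) : ideleGroup K) : AdeleRing (𝓞 K) K) *
              (((principalIdele K (a ^ (n - 1 - (j : ℕ))))⁻¹ : ideleGroup K) : AdeleRing (𝓞 K) K)) := by
          rw [Units.val_mul]; ring
      _ = algebraMap K (AdeleRing (𝓞 K) K) a *
            (((u : GL (Fin n) (AdeleRing (𝓞 K) K)) : Matrix (Fin n) (Fin n) (AdeleRing (𝓞 K) K)) i j) := by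
          rw [Units.mul_inv, mul_one, hval]
  · rw [mul_zero]

/-- Hence **the generic character of the conjugate is the dilated generic character**:
`ψ_N(d_a u d_a⁻¹) = (aψ)_N(u)` with `(aψ)(x) = ψ(a x)`. [folklore] -/
theorem whittakerCharFun_unipotentDiagConj_pow (ψ : AddChar (AdeleRing (𝓞 K) K) Circle) (a : Kˣ)
    (u : ↥(adelicUnipotent n K)) :
    whittakerCharFun ψ (unipotentDiagConj (fun i : Fin n => principalIdele K (a ^ (n - 1 - (i : ℕ)))) u) =
      whittakerCharFun (ψ.mulShift (algebraMap K (AdeleRing (𝓞 K) K) a)) u := by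
  rw [whittakerCharFun_apply, whittakerCharFun_apply, AddChar.mulShift_apply,
    superdiagSum_unipotentDiagConj_pow]

variable [MeasurableSpace ↥(adelicUnipotent n K)] [BorelSpace ↥(adelicUnipotent n K)]

omit [BorelSpace ↥(adelicUnipotent n K)] in
/-- The Whittaker coefficient does not see a rescaling of the measure (it is normalised by the
mass of the fundamental domain). [folklore] -/
theorem whittakerCoeff_smul_measure (ν : Measure ↥(adelicUnipotent n K)) (𝓕 : Set ↥(adelicUnipotent n K))
    (ψ : AddChar (AdeleRing (𝓞 K) K) Circle) (φ : GL (Fin n) (AdeleRing (𝓞 K) K) → ℂ) {c : ℝ≥0∞}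
    (hc0 : c ≠ 0) (hctop : c ≠ ⊤) (g : GL (Fin n) (AdeleRing (𝓞 K) K)) :
    whittakerCoeff (c • ν) 𝓕 ψ φ g = whittakerCoeff ν 𝓕 ψ φ g := by
  simp only [whittakerCoeff_def, Measure.restrict_smul, integral_smul_measure, Measure.smul_apply,
    smul_eq_mul, ENNReal.toReal_mul]
  rw [smul_smul, mul_inv, mul_right_comm, inv_mul_cancel₀ (ENNReal.toReal_ne_zero.2 ⟨hc0, hctop⟩),
    one_mul]

omit [BorelSpace ↥(adelicUnipotent n K)] in
/-- The same for a rescaling by a positive real constant. [folklore] -/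
theorem whittakerCoeff_nnreal_smul_measure (ν : Measure ↥(adelicUnipotent n K))
    (𝓕 : Set ↥(adelicUnipotent n K)) (ψ : AddChar (AdeleRing (𝓞 K) K) Circle)
    (φ : GL (Fin n) (AdeleRing (𝓞 K) K) → ℂ) {c : ℝ≥0} (hc0 : c ≠ 0)
    (g : GL (Fin n) (AdeleRing (𝓞 K) K)) :
    whittakerCoeff (c • ν) 𝓕 ψ φ g = whittakerCoeff ν 𝓕 ψ φ g := by
  have h : (c • ν : Measure ↥(adelicUnipotent n K)) = (c : ℝ≥0∞) • ν := rfl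
  rw [h]
  exact whittakerCoeff_smul_measure ν 𝓕 ψ φ (ENNReal.coe_ne_zero.2 hc0) ENNReal.coe_ne_top g

/-- **A topological automorphism of `N_n(𝔸_K)` multiplies Haar measure by a constant**:
`θ_* ν = χ(θ)⁻¹ ν` (Mathlib `mulEquivHaarChar`). [folklore] -/
theorem map_continuousMulEquiv_eq_smul (ν : Measure ↥(adelicUnipotent n K)) [IsHaarMeasure ν]
    (θ : ↥(adelicUnipotent n K) ≃ₜ* ↥(adelicUnipotent n K)) :
    ν.map θ = ((mulEquivHaarChar θ)⁻¹ : ℝ≥0) • ν := by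
  have h := mulEquivHaarChar_smul_map ν θ
  have hc : mulEquivHaarChar θ ≠ 0 := (mulEquivHaarChar_pos θ).ne'
  calc ν.map θ = ((mulEquivHaarChar θ)⁻¹ * mulEquivHaarChar θ) • ν.map θ := by
        rw [inv_mul_cancel₀ hc, one_smul]
    _ = (mulEquivHaarChar θ)⁻¹ • (mulEquivHaarChar θ • ν.map θ) := by rw [smul_smul]
    _ = _ := by rw [h]

/-- **The image of a fundamental domain of `N_n(K)` under conjugation by a rational diagonal matrix
is a fundamental domain** (the conjugation is an automorphism of `N_n(𝔸_K)` preserving `N_n(K)` and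
the Haar measure class). [folklore] -/
theorem isFundamentalDomain_image_unipotentDiagConj (ν : Measure ↥(adelicUnipotent n K))
    [IsHaarMeasure ν] {𝓕 : Set ↥(adelicUnipotent n K)}
    (h𝓕 : IsFundamentalDomain ↥(rationalUnipotent n K) 𝓕 ν) (c : Fin n → Kˣ) :
    IsFundamentalDomain ↥(rationalUnipotent n K)
      (unipotentDiagConj (fun i => principalIdele K (c i)) '' 𝓕) ν := by
  set θ := unipotentDiagConj (n := n) (K := K) (fun i => principalIdele K (c i)) with hθ
  have hsymm : ∀ γ : ↥(rationalUnipotent n K), θ.symm γ ∈ rationalUnipotent n K := by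
    intro γ
    have h := unipotentDiagConj_principalIdele_mem_rationalUnipotent (fun i => (c i)⁻¹) γ.2
    have hd : (fun i => principalIdele K (c i)⁻¹) = (fun i => principalIdele K (c i))⁻¹ := by
      funext i; rw [Pi.inv_apply, map_inv]
    rw [hd] at h
    exact h
  let e : ↥(rationalUnipotent n K) ≃ ↥(rationalUnipotent n K) :=
    { toFun := fun γ => ⟨θ.symm γ, hsymm γ⟩
      invFun := fun γ => ⟨θ γ, unipotentDiagConj_principalIdele_mem_rationalUnipotent c γ.2⟩
      left_inv := fun γ => Subtype.ext (θ.apply_symm_apply _)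
      right_inv := fun γ => Subtype.ext (θ.symm_apply_apply _) }
  have hq : Measure.QuasiMeasurePreserving θ.symm ν ν := by
    refine ⟨θ.symm.continuous.measurable, ?_⟩
    rw [map_continuousMulEquiv_eq_smul ν θ.symm]
    exact Measure.smul_absolutelyContinuous
  refine h𝓕.image_of_equiv θ.toEquiv hq e fun γ u => ?_
  change θ ((θ.symm γ : ↥(adelicUnipotent n K)) * u) = (γ : ↥(adelicUnipotent n K)) * θ u
  rw [map_mul, θ.apply_symm_apply]

/-- **Dilating the additive character moves the argument by the dilation matrix**: for `φ` left
`GL_n(K)`-invariant, a global additive character `ψ`, a Haar measure `ν` and a fundamental domain `𝓕`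
of `N_n(K)`, and `a ∈ Kˣ`,
`W^{aψ}_φ(g) = W^{ψ}_φ(d_a g)`, `d_a = diag(a^{n-1}, …, a, 1)`, `(aψ)(x) = ψ(a x)`:
substitute `u ↦ d_a u d_a⁻¹` in `∫_{N_n(K)∖N_n(𝔸_K)} φ(u g) (aψ)_N(u)⁻¹ du`
(`(aψ)_N(u) = ψ_N(d_a u d_a⁻¹)`, `φ(d_a⁻¹ u' d_a g) = φ(u' d_a g)`); the constant by which the
conjugation multiplies the Haar measure cancels against the normalisation, and the image of `𝓕` is
again a fundamental domain (Cogdell (2004), §1.1: all generic characters are conjugate under the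
rational torus). [folklore] -/
theorem whittakerCoeff_mulShift (ν : Measure ↥(adelicUnipotent n K)) [IsHaarMeasure ν]
    {𝓕 : Set ↥(adelicUnipotent n K)} (h𝓕 : IsFundamentalDomain ↥(rationalUnipotent n K) 𝓕 ν)
    {ψ : AddChar (AdeleRing (𝓞 K) K) Circle} (hψ : IsGlobalAddChar K ψ)
    {φ : GL (Fin n) (AdeleRing (𝓞 K) K) → ℂ} (hφ : IsLeftInvariant (AdelicGroupData.gl n K) φ)
    (a : Kˣ) (g : GL (Fin n) (AdeleRing (𝓞 K) K)) :
    whittakerCoeff ν 𝓕 (ψ.mulShift (algebraMap K (AdeleRing (𝓞 K) K) a)) φ g =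
      whittakerCoeff ν 𝓕 ψ φ
        (glDiagonal n (AdeleRing (𝓞 K) K) (fun i : Fin n => principalIdele K (a ^ (n - 1 - (i : ℕ)))) * g) := by
  set d : Fin n → ideleGroup K := fun i => principalIdele K (a ^ (n - 1 - (i : ℕ))) with hd
  set θ := unipotentDiagConj (n := n) (K := K) d with hθ
  set D := glDiagonal n (AdeleRing (𝓞 K) K) d with hD
  have hDrat : D ∈ (AdelicGroupData.gl n K).arithmeticSubgroup :=
    glDiagonal_principalIdele_mem_rationalPointsGL n K _
  -- the integrand of `W^ψ(D g)`
  set G : ↥(adelicUnipotent n K) → ℂ := fun y =>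
    φ ((y : GL (Fin n) (AdeleRing (𝓞 K) K)) * (D * g)) * conj (whittakerCharFun ψ y) with hG
  have hpt : ∀ u : ↥(adelicUnipotent n K),
      φ ((u : GL (Fin n) (AdeleRing (𝓞 K) K)) * g) *
          conj (whittakerCharFun (ψ.mulShift (algebraMap K (AdeleRing (𝓞 K) K) a)) u) = G (θ u) := by
    intro u
    simp only [hG, hθ]
    rw [whittakerCharFun_unipotentDiagConj_pow, coe_unipotentDiagConj]
    congr 1
    rw [show glDiagonal n (AdeleRing (𝓞 K) K) d * (u : GL (Fin n) (AdeleRing (𝓞 K) K)) *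
        (glDiagonal n (AdeleRing (𝓞 K) K) d)⁻¹ * (D * g) = D * ((u : GL (Fin n) (AdeleRing (𝓞 K) K)) * g) by
      rw [hD]; group]
    exact (hφ D hDrat _).symm
  -- change of variables `u ↦ θ u`
  have hmp : MeasurePreserving θ ν (ν.map θ) := ⟨θ.continuous.measurable, rfl⟩
  have hemb : MeasurableEmbedding θ := θ.toHomeomorph.measurableEmbedding
  have hint : ∫ u in 𝓕, G (θ u) ∂ν = ∫ y in θ '' 𝓕, G y ∂(ν.map θ) :=
    (hmp.setIntegral_image_emb hemb G 𝓕).symm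
  have hmeas : ν 𝓕 = (ν.map θ) (θ '' 𝓕) := by
    rw [hemb.map_apply, Set.preimage_image_eq _ hemb.injective]
  have hc0 : ((mulEquivHaarChar θ)⁻¹ : ℝ≥0) ≠ 0 := inv_ne_zero (mulEquivHaarChar_pos θ).ne'
  calc whittakerCoeff ν 𝓕 (ψ.mulShift (algebraMap K (AdeleRing (𝓞 K) K) a)) φ g
      = ((ν 𝓕).toReal⁻¹ : ℝ) • ∫ u in 𝓕, G (θ u) ∂ν := by
        simp only [whittakerCoeff_def, hpt]
    _ = whittakerCoeff (ν.map θ) (θ '' 𝓕) ψ φ (D * g) := by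
        rw [whittakerCoeff_def, hint, hmeas]
    _ = whittakerCoeff (((mulEquivHaarChar θ)⁻¹ : ℝ≥0) • ν) (θ '' 𝓕) ψ φ (D * g) := by
        rw [map_continuousMulEquiv_eq_smul ν θ]
    _ = whittakerCoeff ν (θ '' 𝓕) ψ φ (D * g) := whittakerCoeff_nnreal_smul_measure ν _ ψ φ hc0 _
    _ = whittakerCoeff ν 𝓕 ψ φ (D * g) := by
        haveI := isMulRightInvariant_of_isHaarMeasure_adelicUnipotent ν
        exact whittakerCoeff_eq_of_isFundamentalDomain
          (isFundamentalDomain_image_unipotentDiagConj ν h𝓕 _) h𝓕 hψ hφ _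

end Transport

/-! ### Stripping the `v`-part of a torus point by Shintani's relations -/

section Strip

variable {n : ℕ} {K : Type} [Field K] [NumberField K] {v : HeightOneSpectrum (𝓞 K)}
  {ϖ : (v.adicCompletion K)ˣ} {x : Fin n → ℂ} {W : GL (Fin n) (AdeleRing (𝓞 K) K) → ℂ}

/-- The entries of a torus element integral at `v` have `v`-valuations `exp(-m_i)`, `m ∈ ℕⁿ`.
[folklore] -/
theorem exists_valued_snd_eq_exp_neg {a : Fin n → ideleGroup K}
    (ha : ∀ i, Valued.v (((a i : ideleGroup K) : AdeleRing (𝓞 K) K).2 v) ≤ 1) :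
    ∃ m : Fin n → ℕ, ∀ i,
      Valued.v (((a i : ideleGroup K) : AdeleRing (𝓞 K) K).2 v) = WithZero.exp (-(m i : ℤ)) := by
  refine ⟨fun i => (-(WithZero.log (Valued.v (((a i : ideleGroup K) : AdeleRing (𝓞 K) K).2 v)))).toNat,
    fun i => ?_⟩
  have h0 := valued_snd_ne_zero (a i) v
  have hlog : WithZero.log (Valued.v (((a i : ideleGroup K) : AdeleRing (𝓞 K) K).2 v)) ≤ 0 :=
    WithZero.exp_le_exp.1 (by rw [WithZero.exp_log h0, WithZero.exp_zero]; exact ha i)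
  simp only
  rw [Int.toNat_of_nonneg (neg_nonneg.2 hlog), neg_neg, WithZero.exp_log h0]

/-- Components of `(ϖ^m)⁻¹ · a`. [folklore] -/
theorem localTorusPow_inv_mul_snd_apply (m : Fin n → ℕ) (a : Fin n → ideleGroup K) (i : Fin n)
    (w : HeightOneSpectrum (𝓞 K)) :
    ((((localTorusPow ϖ m)⁻¹ * a) i : ideleGroup K) : AdeleRing (𝓞 K) K).2 w =
      ((((localTorusPow ϖ m i : ideleGroup K) : AdeleRing (𝓞 K) K).2 w))⁻¹ *
        ((a i : ideleGroup K) : AdeleRing (𝓞 K) K).2 w := by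
  rw [Pi.mul_apply, Pi.inv_apply, GaloisRepresentations.ideleGroup_val_snd_mul,
    GaloisRepresentations.ideleGroup_val_inv_snd]

/-- **Stripping the `v`-part of a torus point.** Let `W` be an unramified Whittaker–Hecke datum at
`v` in the torus sense (`IsTorusUnramifiedAt`: sphericity and Shintani's relations
`W(ι_v(ϖ^μ) g) = q_v^{-b(μ)/2} s_μ(x) W(g)`), and let `diag(a) k` be a torus point with `a`
integral at `v` at which `W` does not vanish. Writing `a_{i,v} = ϖ^{m_i} u_i` with units `u_i`,
the point `diag(a') k`, `a' = ϖ_v^{-m} a` (units at `v`, unchanged off `v`), satisfies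
`W(diag(a) k) = q_v^{-b(m)/2} s_m(x) W(diag(a') k)`, so `W(diag(a') k) ≠ 0` as well. [folklore] -/
theorem IsTorusUnramifiedAt.exists_apply_torusPoint_ne_zero_valued_eq_one
    (hW : IsTorusUnramifiedAt n K W v ϖ x) {a : Fin n → ideleGroup K}
    (ha : ∀ i, Valued.v (((a i : ideleGroup K) : AdeleRing (𝓞 K) K).2 v) ≤ 1)
    {k : ↥(maximalCompactAdelic n K)} (hne : W (torusPoint n K (a, k)) ≠ 0) :
    ∃ a' : Fin n → ideleGroup K,
      (∀ i, Valued.v (((a' i : ideleGroup K) : AdeleRing (𝓞 K) K).2 v) = 1) ∧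
      (∀ i w, w ≠ v → Valued.v (((a' i : ideleGroup K) : AdeleRing (𝓞 K) K).2 w) =
        Valued.v (((a i : ideleGroup K) : AdeleRing (𝓞 K) K).2 w)) ∧
      (∀ i, ((a' i : ideleGroup K) : AdeleRing (𝓞 K) K).1 = ((a i : ideleGroup K) : AdeleRing (𝓞 K) K).1) ∧
      W (torusPoint n K (a', k)) ≠ 0 := by
  obtain ⟨m, hm⟩ := exists_valued_snd_eq_exp_neg ha
  set a' : Fin n → ideleGroup K := (localTorusPow ϖ m)⁻¹ * a with ha'
  have haa' : a = localTorusPow ϖ m * a' := by rw [ha', mul_inv_cancel_left]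
  have hv' : ∀ i, Valued.v (((a' i : ideleGroup K) : AdeleRing (𝓞 K) K).2 v) = 1 := by
    intro i
    rw [ha', localTorusPow_inv_mul_snd_apply, map_mul, map_inv₀, localTorusPow_snd_apply_self,
      Units.val_pow_eq_pow_val, map_pow, hW.valued_eq, hm i, ← WithZero.exp_nsmul, ← WithZero.exp_neg,
      ← WithZero.exp_add, nsmul_eq_mul, mul_neg, mul_one, neg_neg, add_neg_cancel, WithZero.exp_zero]
  have hw' : ∀ i w, w ≠ v → Valued.v (((a' i : ideleGroup K) : AdeleRing (𝓞 K) K).2 w) =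
      Valued.v (((a i : ideleGroup K) : AdeleRing (𝓞 K) K).2 w) := by
    intro i w hw
    rw [ha', localTorusPow_inv_mul_snd_apply, localTorusPow_snd_apply_of_ne ϖ m i hw, inv_one, one_mul]
  have hinf : ∀ i, ((a' i : ideleGroup K) : AdeleRing (𝓞 K) K).1 =
      ((a i : ideleGroup K) : AdeleRing (𝓞 K) K).1 := by
    intro i
    rw [ha', Pi.mul_apply, Pi.inv_apply, GaloisRepresentations.ideleGroup_val_fst_mul]
    have h1 : (((localTorusPow ϖ m i)⁻¹ : ideleGroup K) : AdeleRing (𝓞 K) K).1 = 1 := by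
      have := GaloisRepresentations.ideleGroup_val_inv_fst_mul (localTorusPow ϖ m i)
      rwa [localTorusPow_fst, mul_one] at this
    rw [h1, one_mul]
  refine ⟨a', hv', hw', hinf, fun h0 => hne ?_⟩
  have hpt : torusPoint n K (a, k) =
      GLn.ofLocal n K v (piPowGL ϖ.ne_zero m) * torusPoint n K (a', k) := by
    simp only [torusPoint]
    rw [haa', map_mul, glDiagonal_localTorusPow ϖ.ne_zero m, mul_assoc]
  rw [hpt, hW.apply_ofLocal_piPowGL_mul (localComponent_torusPoint_mem_glInt hv' k) m, h0, mul_zero]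

end Strip

/-! ### From a non-vanishing point to a good torus point -/

section GoodPoint

variable {n : ℕ} {K : Type} [Field K] [NumberField K] {W : GL (Fin n) (AdeleRing (𝓞 K) K) → ℂ}

variable {v : HeightOneSpectrum (𝓞 K)} {ϖ : (v.adicCompletion K)ˣ} {x : Fin n → ℂ}

/-- **A good torus point at `v`.** Let `W` satisfy `W((t · 1_n) g) = W(g)` for `t ∈ Kˣ` and be an
unramified Whittaker–Hecke datum at `v` in the torus sense. If `W(diag(a) k) ≠ 0` for some torus
point, then `W(diag(a') k) ≠ 0` for a torus point with `a'` in the unit box at `v` **and integral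
at every finite place**: clear the denominators of `a` by a rational scalar (which does not change
`W`), then strip the `v`-part by Shintani's relations. [folklore] -/
theorem IsTorusUnramifiedAt.exists_unitBox_integral_apply_torusPoint_ne_zero
    (hW : IsTorusUnramifiedAt n K W v ϖ x)
    (hWZ : ∀ (t : Kˣ) (g : GL (Fin n) (AdeleRing (𝓞 K) K)),
      W (glDiagonal n (AdeleRing (𝓞 K) K) (fun _ => principalIdele K t) * g) = W g)
    {a : Fin n → ideleGroup K} {k : ↥(maximalCompactAdelic n K)} (hne : W (torusPoint n K (a, k)) ≠ 0) :
    ∃ a' : Fin n → ideleGroup K, a' ∈ unitBox ({v} : Set (HeightOneSpectrum (𝓞 K))) ∧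
      (∀ i w, Valued.v (((a' i : ideleGroup K) : AdeleRing (𝓞 K) K).2 w) ≤ 1) ∧
      W (torusPoint n K (a', k)) ≠ 0 := by
  obtain ⟨t, -, ht⟩ := exists_principalIdele_mul_valued_snd_le_one a
  set a₁ : Fin n → ideleGroup K := fun i => principalIdele K t * a i with ha₁
  have hne₁ : W (torusPoint n K (a₁, k)) ≠ 0 := by
    rwa [ha₁, torusPoint_principalIdele_mul, hWZ]
  obtain ⟨a', hv', hw', -, hne'⟩ :=
    hW.exists_apply_torusPoint_ne_zero_valued_eq_one (a := a₁) (fun i => ht i v) hne₁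
  refine ⟨a', fun w hw i => ?_, fun i w => ?_, hne'⟩
  · rw [Set.mem_singleton_iff.1 hw]
    exact hv' i
  · by_cases hw : w = v
    · subst hw
      exact (hv' i).le
    · rw [hw' i w hw]
      exact ht i w

end GoodPoint

/-! ### The last entry of an integral torus element -/

section LastEntry

variable {n : ℕ} {K : Type} [Field K] [NumberField K]

/-- If all entries of `a` are integral at every finite place, so is its last entry (`1` for `n = 0`).
[folklore] -/
theorem valued_snd_lastEntry_le_one {a : Fin n → ideleGroup K}
    (ha : ∀ i w, Valued.v (((a i : ideleGroup K) : AdeleRing (𝓞 K) K).2 w) ≤ 1)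
    (w : HeightOneSpectrum (𝓞 K)) :
    Valued.v (((lastEntry a : ideleGroup K) : AdeleRing (𝓞 K) K).2 w) ≤ 1 := by
  unfold lastEntry
  split_ifs with h
  · exact ha _ w
  · rw [Units.val_one]
    exact le_of_eq (by
      rw [show (1 : AdeleRing (𝓞 K) K).2 w = (1 : HeightOneSpectrum.adicCompletion K w) from rfl, map_one])

end LastEntry

/-! ### The unfolded integral does not see the dilation matrix -/

section Dilation

variable {n : ℕ} {K : Type} [Field K] [NumberField K]

/-- The last entry of the dilation torus element `(a^{n-1}, …, a, 1)` is `1`. [folklore] -/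
theorem lastEntry_principalIdele_pow (a : Kˣ) :
    lastEntry (fun i : Fin n => principalIdele K (a ^ (n - 1 - (i : ℕ)))) = 1 := by
  unfold lastEntry
  split_ifs with h
  · simp
  · rfl

/-- The dilation torus element has torus weight `1` (product formula). [folklore] -/
theorem torusWeight_principalIdele (σ : ℝ) (c : Fin n → Kˣ) :
    torusWeight n K σ (fun i => principalIdele K (c i)) = 1 := by
  unfold torusWeight
  refine Finset.prod_eq_one fun i _ => ?_
  dsimp only
  rw [ideleNorm_principal (x := principalIdele K (c i)) ⟨c i, rfl⟩, NNReal.coe_one, Real.one_rpow]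

variable [MeasurableSpace (ideleGroup K)] [BorelSpace (ideleGroup K)]

attribute [local instance] adelicBorel borelSpace_adelic locallyCompactSpace_adelic
  secondCountableTopology_gl_adelic secondCountableTopology_ideleGroup

variable (νA : Measure (Fin n → ideleGroup K)) [νA.IsMulLeftInvariant] [SFinite νA]
  (νK : Measure ↥(maximalCompactAdelic n K)) [SFinite νK]

/-- **The unfolded Rankin–Selberg integral of `g ↦ W(d_a g)` equals that of `W`** for the dilation
matrix `d_a = diag(a^{n-1}, …, a, 1)`, `a ∈ Kˣ`: `diag(d_a) diag(b) k = diag(d_a b) k`, the last row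
and hence `Φ(e_n ·)` are unchanged (`(d_a)_n = 1`), `|det d_a|^σ δ_B(d_a)⁻¹ = 1` by the product formula,
and the Haar measure of the torus is invariant under `b ↦ d_a b`. [folklore] -/
theorem rankinSelbergTorusIntegral_eq_of_apply_glDiagonal_pow_mul
    {W W' : GL (Fin n) (AdeleRing (𝓞 K) K) → ℂ} (a : Kˣ)
    (hWW' : ∀ g, W' g = W (glDiagonal n (AdeleRing (𝓞 K) K)
      (fun i : Fin n => principalIdele K (a ^ (n - 1 - (i : ℕ)))) * g))
    (Φ : (Fin n → AdeleRing (𝓞 K) K) → ℝ) (σ : ℝ) :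
    rankinSelbergTorusIntegral n K νA νK W' Φ σ = rankinSelbergTorusIntegral n K νA νK W Φ σ := by
  set d : Fin n → ideleGroup K := fun i => principalIdele K (a ^ (n - 1 - (i : ℕ))) with hd
  set T : (Fin n → ideleGroup K) × ↥(maximalCompactAdelic n K) →
      (Fin n → ideleGroup K) × ↥(maximalCompactAdelic n K) :=
    Prod.map (fun b => d * b) (id : ↥(maximalCompactAdelic n K) → ↥(maximalCompactAdelic n K)) with hT
  have hint : ∀ p, torusIntegrand n K W' Φ σ p = torusIntegrand n K W Φ σ (T p) := by
    rintro ⟨b, k⟩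
    simp only [torusIntegrand, hT, Prod.map, id]
    rw [hWW', ← torusPoint_mul, torusWeight_mul, hd, torusWeight_principalIdele, one_mul,
      torusPoint_mul, lastRow_glDiagonal_mul, lastEntry_principalIdele_pow, Units.val_one, one_smul]
  unfold rankinSelbergTorusIntegral
  simp_rw [hint]
  have hmp : MeasurePreserving T (νA.prod νK) (νA.prod νK) :=
    (measurePreserving_mul_left νA d).prod (MeasurePreserving.id νK)
  have hemb : MeasurableEmbedding T :=
    (MeasurableEquiv.mulLeft d).measurableEmbedding.prodMap MeasurableEmbedding.id
  exact hmp.lintegral_comp_emb hemb _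

end Dilation

/-! ### The torus sum at a single unramified place -/

section Cuspidal

open ValuativeRel

variable {n : ℕ} {K : Type} [Field K] [NumberField K]
  {μ : Measure (AdelicGroupData.gl n K).automorphicQuotient}
  [(AdelicGroupData.gl n K).IsAutomorphicMeasure μ]
variable [MeasurableSpace ↥(adelicUnipotent n K)] [BorelSpace ↥(adelicUnipotent n K)]
variable [MeasurableSpace (ideleGroup K)] [BorelSpace (ideleGroup K)]

attribute [local instance] adelicBorel borelSpace_adelic locallyCompactSpace_adelic
  secondCountableTopology_gl_adelic secondCountableTopology_ideleGroup

/-- **The unramified Rankin–Selberg torus sum of a cusp form is finite at every unramified place,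
granted genericity and the finiteness of the unfolded integral — for a class `Pw` of smoothing
weights.** (hex) asks that every non-zero `K(𝔫)`-fixed vector of `Π` has a non-zero smoothing by a
weight of the class which is left `K(𝔫)`-invariant; (hZ) and (hfin) are only asked for weights of
the class (all weights: `schurSelfSum_ne_top_of_rankinSelberg`; test functions:
`schurSelfSum_ne_top_of_rankinSelberg_testFunction`). Let `Π` be a cuspidal automorphic
representation of `GL_n(𝔸_K)` with Satake family `α` off an *arbitrary* set `S`, `v ∉ S`, `x` an
enumeration of `α v` and `σ` real. Assume, for the Whittaker coefficients `W_φ` (Tate's character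
`ψ`, a Haar measure `ν` on `N_n(𝔸_K)`, Tate's box) of the smoothed vectors `φ = invQuot (S_η f)`,
`f ∈ Π`:
(hZ) *genericity* — `S_η f ≠ 0 ⇒ W_φ ≢ 0` (Shalika, Piatetski-Shapiro; Cogdell (2004), Thm. 1.1 and
its corollary); and (hfin) *finiteness of the unfolded Rankin–Selberg integral at `σ`* —
`Ψ(σ; W_φ, W̄_φ, Φ_∞ ⊗ 𝟙_{𝒪̂ⁿ}) < ∞` (Jacquet–Shalika (1981), §4; Cogdell (2004), §2.3: absolute
convergence of `∫ |φ|² E(·, Φ; σ)` for `σ > 1` and unfolding). Then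
`T_v(q_v^{-σ}) = ∑_λ |s_λ(x)|² q_v^{-|λ|σ} < ∞`.

Proof: by `IsSatakeFamilyOf`, `Π` has a non-zero `K(𝔫₀)`-fixed Hecke eigenvector `f` at `v`
with `v ∤ 𝔫₀`; smooth it (hex). Replace Tate's character by a
dilate `aψ`, `a ∈ Kˣ`, of conductor `𝒪_v` at `v`
(`IsGlobalAddChar.exists_mulShift_adicComponent_hasConductorExp_zero`); then `W^{aψ}_φ` is an
unramified Whittaker–Hecke datum at `v` in the torus sense
(`exists_isTorusUnramifiedAt_whittakerCoeff_smoothedForm`), while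
`W^{aψ}_φ(g) = W^{ψ}_φ(d_a g)` (`whittakerCoeff_mulShift`) transports genericity and the finiteness of
the unfolded integral (`rankinSelbergTorusIntegral_eq_of_apply_glDiagonal_pow_mul`) from `ψ`. A
non-vanishing point of `W^{aψ}_φ` is moved to a torus point in the unit box at `v` and integral at all
finite places (`exists_torusPoint_apply_ne_zero`,
`IsTorusUnramifiedAt.exists_unitBox_integral_apply_torusPoint_ne_zero`), which makes the unit-box
integral positive (`setLIntegral_torusIntegrand_unitBox_ne_zero`); the Euler lower bound
`T_v(q_v^{-σ}) · c ≤ Ψ(σ)` (`exists_prod_schurSelfSum_le_of_cuspidal` with `Good = {v}`) concludes.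
[cite: JacquetShalikaAJM1981, §2 Prop. (2.3), §4, Thm. (5.3) proof] -/
theorem schurSelfSum_ne_top_of_rankinSelberg_of_weights
    (Pw : ((AdelicGroupData.gl n K).Adelic → ℝ) → Prop) (P : CuspidalAutomorphicRepGL n K μ)
    {S : Set (HeightOneSpectrum (𝓞 K))} {α : SatakeFamily K} (hα : IsSatakeFamilyOf P S α)
    {v : HeightOneSpectrum (𝓞 K)} (hv : v ∉ S) {x : Fin n → ℂ}
    (hx : (Finset.univ : Finset (Fin n)).val.map x = α v) {σ : ℝ}
    (ν : Measure ↥(adelicUnipotent n K)) [IsHaarMeasure ν]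
    {Φinf : (Fin n → InfiniteAdeleRing K) → ℝ} (hΦc : Continuous Φinf) (hΦpos : ∀ z, 0 < Φinf z)
    (νA : Measure (Fin n → ideleGroup K)) [νA.IsMulLeftInvariant] [SFinite νA] [νA.IsOpenPosMeasure]
    (νK : Measure ↥(maximalCompactAdelic n K)) [SFinite νK] [νK.IsOpenPosMeasure]
    (hex : ∀ {𝔫 : Ideal (𝓞 K)}, 𝔫 ≠ 0 → ∀ f : P.1.toSubmodule,
      f ∈ P.1.fixedVectors (principalCongruenceLevel n K 𝔫) → f ≠ 0 →
        ∃ η : (AdelicGroupData.gl n K).Adelic → ℝ, Pw η ∧ Continuous η ∧ HasCompactSupport η ∧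
          (∀ k : (AdelicGroupData.gl n K).Adelic, k ∈ principalCongruenceLevel n K 𝔫 →
            ∀ g : (AdelicGroupData.gl n K).Adelic, η (k * g) = η g) ∧
          smoothedForm η (f : (AdelicGroupData.gl n K).L2 μ) ≠ 0)
    (hZ : ∀ {η : (AdelicGroupData.gl n K).Adelic → ℝ}, Pw η → Continuous η → HasCompactSupport η →
      ∀ f : P.1.toSubmodule, smoothedForm η (f : (AdelicGroupData.gl n K).L2 μ) ≠ 0 →
        ∃ g : GL (Fin n) (AdeleRing (𝓞 K) K), whittakerCoeff ν (unipotentTateDomain n K) (adeleAddChar K)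
          (invQuot (AdelicGroupData.gl n K) (smoothedForm η (f : (AdelicGroupData.gl n K).L2 μ))) g ≠ 0)
    (hfin : ∀ {η : (AdelicGroupData.gl n K).Adelic → ℝ}, Pw η → Continuous η → HasCompactSupport η →
      ∀ f : P.1.toSubmodule, rankinSelbergTorusIntegral n K νA νK
        (whittakerCoeff ν (unipotentTateDomain n K) (adeleAddChar K)
          (invQuot (AdelicGroupData.gl n K) (smoothedForm η (f : (AdelicGroupData.gl n K).L2 μ))))
        (standardTestFun n K Φinf) σ ≠ ⊤) :
    schurSelfSum x ((v.residueCard : ℝ) ^ (-σ)) ≠ ⊤ := by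
  classical
  -- a non-zero `K(𝔫₀)`-fixed vector, `v ∤ 𝔫₀`, and a smoothing weight
  obtain ⟨𝔫₀, h𝔫₀, hv𝔫₀, ϖ₀, hsat⟩ := hα v hv
  obtain ⟨-, -, f₀, hf₀K, hf₀0, -⟩ := hsat
  obtain ⟨η, hPη, hη, hηs, hηK, hFne⟩ := hex h𝔫₀ f₀ hf₀K hf₀0
  -- a dilate of Tate's character of conductor `𝒪_v` at `v`
  obtain ⟨a, ha0, hcond⟩ := (isGlobalAddChar_adeleAddChar (K := K)).exists_mulShift_adicComponent_hasConductorExp_zero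
    v (adicComponent_adeleAddChar_ne_one v)
  set ψ : AddChar (AdeleRing (𝓞 K) K) Circle :=
    (adeleAddChar K).mulShift (algebraMap K (AdeleRing (𝓞 K) K) a) with hψdef
  have hψ : IsGlobalAddChar K ψ := (isGlobalAddChar_adeleAddChar (K := K)).mulShift ha0
  have hψv : ∀ c ∈ 𝒪[v.adicCompletion K], ψ.adicComponent v c = 1 := fun c hc =>
    hcond.eq_one_of_mem hc
  have hψv' : ∀ ϖ : v.adicCompletion K, Valued.v ϖ = WithZero.exp (-1 : ℤ) →
      ∃ c ∈ 𝒪[v.adicCompletion K], ψ.adicComponent v (ϖ⁻¹ * c) ≠ 1 := fun ϖ hϖ =>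
    hcond.exists_apply_inv_mul_ne_one (isUniformizingElement_of_valued_eq K v hϖ)
  -- the Whittaker coefficients
  have h𝓕 : IsFundamentalDomain ↥(rationalUnipotent n K) (unipotentTateDomain n K) ν :=
    isFundamentalDomain_unipotentTateDomain ν
  have h𝓕c : IsCompact (closure (unipotentTateDomain n K)) := isCompact_closure_unipotentTateDomain
  have h𝓕m : MeasurableSet (unipotentTateDomain n K) := measurableSet_unipotentTateDomain
  haveI := isMulRightInvariant_of_isHaarMeasure_adelicUnipotent ν
  set φ : GL (Fin n) (AdeleRing (𝓞 K) K) → ℂ :=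
    invQuot (AdelicGroupData.gl n K) (smoothedForm η (f₀ : (AdelicGroupData.gl n K).L2 μ)) with hφ
  have hφinv : IsLeftInvariant (AdelicGroupData.gl n K) φ := isLeftInvariant_invQuot _ _
  have hφc : Continuous φ :=
    (continuous_smoothedForm hη hηs _).comp
      ((AdelicGroupData.gl n K).continuous_toAutomorphicQuotient.comp
        (continuous_inv : Continuous fun g : (AdelicGroupData.gl n K).Adelic => g⁻¹))
  set W : GL (Fin n) (AdeleRing (𝓞 K) K) → ℂ := whittakerCoeff ν (unipotentTateDomain n K) ψ φ with hW
  set W₀ : GL (Fin n) (AdeleRing (𝓞 K) K) → ℂ :=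
    whittakerCoeff ν (unipotentTateDomain n K) (adeleAddChar K) φ with hW₀
  set a' : Kˣ := Units.mk0 a ha0 with ha'
  set D : GL (Fin n) (AdeleRing (𝓞 K) K) :=
    glDiagonal n (AdeleRing (𝓞 K) K) (fun i : Fin n => principalIdele K (a' ^ (n - 1 - (i : ℕ)))) with hD
  have hWW₀ : ∀ g, W g = W₀ (D * g) := fun g =>
    whittakerCoeff_mulShift ν h𝓕 (isGlobalAddChar_adeleAddChar (K := K)) hφinv a' g
  have hWc : Continuous W := continuous_whittakerCoeff h𝓕m h𝓕c hψ.continuous hφc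
  -- `W` is an unramified torus datum at `v`
  obtain ⟨ϖ, hWv⟩ := exists_isTorusUnramifiedAt_whittakerCoeff_smoothedForm P hα h𝔫₀ hv hv𝔫₀ hη
    hηs hηK f₀ hx h𝓕 h𝓕c hψ hψv hψv'
  -- a good torus point
  obtain ⟨g₁, hg₁⟩ := hZ hPη hη hηs f₀ hFne
  have hg₁' : W (D⁻¹ * g₁) ≠ 0 := by
    rw [hWW₀, mul_inv_cancel_left]
    exact hg₁
  have hWN : ∀ u ∈ upperUnitriangular (Fin n) (AdeleRing (𝓞 K) K), ∀ g, ‖W (u * g)‖ = ‖W g‖ := by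
    intro u hu g
    have h := whittakerCoeff_unipotent_mul (ν := ν) (𝓕 := unipotentTateDomain n K) (ψ := ψ) h𝓕 hψ
      hφinv ⟨u, hu⟩ g
    change W (u * g) = _ * W g at h
    rw [h, norm_mul, whittakerCharFun_apply, Circle.norm_coe, one_mul]
  obtain ⟨a₁, k₁, hne₁⟩ := exists_torusPoint_apply_ne_zero hWN hg₁'
  have hWZ : ∀ (t : Kˣ) (g : GL (Fin n) (AdeleRing (𝓞 K) K)),
      W (glDiagonal n (AdeleRing (𝓞 K) K) (fun _ => principalIdele K t) * g) = W g := fun t g =>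
    whittakerCoeff_glDiagonal_principalIdele_mul ν _ ψ hφinv t g
  obtain ⟨a₂, ha₂box, ha₂int, hne₂⟩ := hWv.exists_unitBox_integral_apply_torusPoint_ne_zero hWZ hne₁
  -- positivity and finiteness of the unfolded integral
  have hpos := setLIntegral_torusIntegrand_unitBox_ne_zero hWc hne₂ ha₂box
    (valued_snd_lastEntry_le_one ha₂int) hΦc hΦpos σ νA νK
  have hfinW : rankinSelbergTorusIntegral n K νA νK W (standardTestFun n K Φinf) σ ≠ ⊤ := by
    rw [rankinSelbergTorusIntegral_eq_of_apply_glDiagonal_pow_mul νA νK a' hWW₀]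
    exact hfin hPη hη hηs f₀
  -- the Euler lower bound at the single place `v`
  obtain ⟨C, hC, hle⟩ := exists_prod_schurSelfSum_le_of_cuspidal P hα h𝔫₀ hη hηs hηK f₀ h𝓕 h𝓕c hψ
    (Good := {v}) (fun w hw => by rw [Set.mem_singleton_iff.1 hw]; exact ⟨hv, hv𝔫₀, hψv, hψv'⟩)
    (x := fun _ => x) (fun w hw => by rw [Set.mem_singleton_iff.1 hw]; exact hx) Φinf νA νK hfinW hpos
  have h1 := hle {v} (by simp)
  rw [Finset.prod_singleton] at h1
  exact ne_top_of_le_ne_top hC h1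

/-- **The unramified Rankin–Selberg torus sum of a cusp form is finite at every unramified place,
granted genericity and the finiteness of the unfolded integral.** Let `Π` be a cuspidal automorphic
representation of `GL_n(𝔸_K)` with Satake family `α` off an *arbitrary* set `S`, `v ∉ S`, `x` an
enumeration of `α v` and `σ` real. Assume, for the Whittaker coefficients `W_φ` (Tate's character
`ψ`, a Haar measure `ν` on `N_n(𝔸_K)`, Tate's box) of the smoothed vectors `φ = invQuot (S_η f)`,
`f ∈ Π`:
(hZ) *genericity* — `S_η f ≠ 0 ⇒ W_φ ≢ 0` (Shalika, Piatetski-Shapiro; Cogdell (2004), Thm. 1.1 and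
its corollary); and (hfin) *finiteness of the unfolded Rankin–Selberg integral at `σ`* —
`Ψ(σ; W_φ, W̄_φ, Φ_∞ ⊗ 𝟙_{𝒪̂ⁿ}) < ∞` (Jacquet–Shalika (1981), §4; Cogdell (2004), §2.3: absolute
convergence of `∫ |φ|² E(·, Φ; σ)` for `σ > 1` and unfolding). Then
`T_v(q_v^{-σ}) = ∑_λ |s_λ(x)|² q_v^{-|λ|σ} < ∞`.

Proof: by `IsSatakeFamilyOf`, `Π` has a non-zero `K(𝔫₀)`-fixed Hecke eigenvector `f` at `v`
with `v ∤ 𝔫₀`; smooth it (`exists_weight_smoothedVector_ne_zero`). Replace Tate's character by a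
dilate `aψ`, `a ∈ Kˣ`, of conductor `𝒪_v` at `v`
(`IsGlobalAddChar.exists_mulShift_adicComponent_hasConductorExp_zero`); then `W^{aψ}_φ` is an
unramified Whittaker–Hecke datum at `v` in the torus sense
(`exists_isTorusUnramifiedAt_whittakerCoeff_smoothedForm`), while
`W^{aψ}_φ(g) = W^{ψ}_φ(d_a g)` (`whittakerCoeff_mulShift`) transports genericity and the finiteness of
the unfolded integral (`rankinSelbergTorusIntegral_eq_of_apply_glDiagonal_pow_mul`) from `ψ`. A
non-vanishing point of `W^{aψ}_φ` is moved to a torus point in the unit box at `v` and integral at all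
finite places (`exists_torusPoint_apply_ne_zero`,
`IsTorusUnramifiedAt.exists_unitBox_integral_apply_torusPoint_ne_zero`), which makes the unit-box
integral positive (`setLIntegral_torusIntegrand_unitBox_ne_zero`); the Euler lower bound
`T_v(q_v^{-σ}) · c ≤ Ψ(σ)` (`exists_prod_schurSelfSum_le_of_cuspidal` with `Good = {v}`) concludes.
[cite: JacquetShalikaAJM1981, §2 Prop. (2.3), §4, Thm. (5.3) proof] -/
theorem schurSelfSum_ne_top_of_rankinSelberg (P : CuspidalAutomorphicRepGL n K μ)
    {S : Set (HeightOneSpectrum (𝓞 K))} {α : SatakeFamily K} (hα : IsSatakeFamilyOf P S α)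
    {v : HeightOneSpectrum (𝓞 K)} (hv : v ∉ S) {x : Fin n → ℂ}
    (hx : (Finset.univ : Finset (Fin n)).val.map x = α v) {σ : ℝ}
    (ν : Measure ↥(adelicUnipotent n K)) [IsHaarMeasure ν]
    {Φinf : (Fin n → InfiniteAdeleRing K) → ℝ} (hΦc : Continuous Φinf) (hΦpos : ∀ z, 0 < Φinf z)
    (νA : Measure (Fin n → ideleGroup K)) [νA.IsMulLeftInvariant] [SFinite νA] [νA.IsOpenPosMeasure]
    (νK : Measure ↥(maximalCompactAdelic n K)) [SFinite νK] [νK.IsOpenPosMeasure]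
    (hZ : ∀ {η : (AdelicGroupData.gl n K).Adelic → ℝ}, Continuous η → HasCompactSupport η →
      ∀ f : P.1.toSubmodule, smoothedForm η (f : (AdelicGroupData.gl n K).L2 μ) ≠ 0 →
        ∃ g : GL (Fin n) (AdeleRing (𝓞 K) K), whittakerCoeff ν (unipotentTateDomain n K) (adeleAddChar K)
          (invQuot (AdelicGroupData.gl n K) (smoothedForm η (f : (AdelicGroupData.gl n K).L2 μ))) g ≠ 0)
    (hfin : ∀ {η : (AdelicGroupData.gl n K).Adelic → ℝ}, Continuous η → HasCompactSupport η →
      ∀ f : P.1.toSubmodule, rankinSelbergTorusIntegral n K νA νK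
        (whittakerCoeff ν (unipotentTateDomain n K) (adeleAddChar K)
          (invQuot (AdelicGroupData.gl n K) (smoothedForm η (f : (AdelicGroupData.gl n K).L2 μ))))
        (standardTestFun n K Φinf) σ ≠ ⊤) :
    schurSelfSum x ((v.residueCard : ℝ) ^ (-σ)) ≠ ⊤ := by
  refine schurSelfSum_ne_top_of_rankinSelberg_of_weights (fun _ => True) P hα hv hx ν hΦc hΦpos νA νK
    (fun h𝔫 f hfK hf0 => ?_) (fun _ hη hηs f hf => hZ hη hηs f hf) (fun _ hη hηs f => hfin hη hηs f)
  obtain ⟨η, hη, hηs, -, hηK, hne⟩ := exists_weight_smoothedVector_ne_zero (W := P.1)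
    (isCompact_principalCongruenceLevel n K h𝔫) hfK hf0
  exact ⟨η, trivial, hη, hηs, hηK, smoothedForm_ne_zero_of_smoothedVector_ne_zero hη hηs hne⟩

/-- **(J) from genericity and the finiteness of the unfolded integral, for a class `Pw` of
smoothing weights** (see `jacquetShalika1981_schurSelfSum_prod_bounded_of_rankinSelberg`). Under the hypotheses (hZ)
and (hfin) of `schurSelfSum_ne_top_of_rankinSelberg` for every `σ > 1`, the boundedness
`JacquetShalika1981_schurSelfSum_prod_bounded` of the partial products `∏_{v ∈ F} T_v(q_v^{-σ})`
off a finite set `S₀(Π)` holds — Jacquet–Shalika's (5.3.3)–(5.3.4) / Lemma (5.2) in the tree's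
torus-sum form: with a non-zero `K(𝔫₀)`-fixed `f ∈ Π` (if there is none the statement is vacuous),
a smoothing `φ = invQuot (S_η f)`, Tate's character `ψ` and a torus point `diag(a) k`, `a` integral,
with `W_φ(diag(a) k) ≠ 0` (genericity, Iwasawa, clearing denominators by a rational scalar), take
`S₀ = supp 𝔫₀ ∪ {ψ_v ramified} ∪ {v : a not a unit at v}`; off `S ⊇ S₀` the Euler lower bound
`exists_prod_schurSelfSum_le_of_cuspidal` applies with `Good = Sᶜ`.
[cite: JacquetShalikaAJM1981, Lemma (5.2), Thm. (5.3) proof, (5.3.3)–(5.3.4)] -/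
theorem jacquetShalika1981_schurSelfSum_prod_bounded_of_rankinSelberg_of_weights
    (Pw : ((AdelicGroupData.gl n K).Adelic → ℝ) → Prop) (ν : Measure ↥(adelicUnipotent n K)) [IsHaarMeasure ν]
    {Φinf : (Fin n → InfiniteAdeleRing K) → ℝ} (hΦc : Continuous Φinf) (hΦpos : ∀ z, 0 < Φinf z)
    (νA : Measure (Fin n → ideleGroup K)) [νA.IsMulLeftInvariant] [SFinite νA] [νA.IsOpenPosMeasure]
    (νK : Measure ↥(maximalCompactAdelic n K)) [SFinite νK] [νK.IsOpenPosMeasure]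
    (hex : ∀ (P : CuspidalAutomorphicRepGL n K μ) {𝔫 : Ideal (𝓞 K)}, 𝔫 ≠ 0 → ∀ f : P.1.toSubmodule,
      f ∈ P.1.fixedVectors (principalCongruenceLevel n K 𝔫) → f ≠ 0 →
        ∃ η : (AdelicGroupData.gl n K).Adelic → ℝ, Pw η ∧ Continuous η ∧ HasCompactSupport η ∧
          (∀ k : (AdelicGroupData.gl n K).Adelic, k ∈ principalCongruenceLevel n K 𝔫 →
            ∀ g : (AdelicGroupData.gl n K).Adelic, η (k * g) = η g) ∧
          smoothedForm η (f : (AdelicGroupData.gl n K).L2 μ) ≠ 0)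
    (hZ : ∀ (P : CuspidalAutomorphicRepGL n K μ) {η : (AdelicGroupData.gl n K).Adelic → ℝ}, Pw η →
      Continuous η → HasCompactSupport η →
      ∀ f : P.1.toSubmodule, smoothedForm η (f : (AdelicGroupData.gl n K).L2 μ) ≠ 0 →
        ∃ g : GL (Fin n) (AdeleRing (𝓞 K) K), whittakerCoeff ν (unipotentTateDomain n K) (adeleAddChar K)
          (invQuot (AdelicGroupData.gl n K) (smoothedForm η (f : (AdelicGroupData.gl n K).L2 μ))) g ≠ 0)
    (hfin : ∀ (P : CuspidalAutomorphicRepGL n K μ) {η : (AdelicGroupData.gl n K).Adelic → ℝ}, Pw η →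
      Continuous η → HasCompactSupport η → ∀ f : P.1.toSubmodule, ∀ ⦃σ : ℝ⦄, 1 < σ →
        rankinSelbergTorusIntegral n K νA νK
          (whittakerCoeff ν (unipotentTateDomain n K) (adeleAddChar K)
            (invQuot (AdelicGroupData.gl n K) (smoothedForm η (f : (AdelicGroupData.gl n K).L2 μ))))
          (standardTestFun n K Φinf) σ ≠ ⊤) :
    JacquetShalika1981_schurSelfSum_prod_bounded (μ := μ) := by
  intro P
  classical
  by_cases hP : ∃ 𝔫₀ : Ideal (𝓞 K), 𝔫₀ ≠ 0 ∧
      ∃ f ∈ P.1.fixedVectors (principalCongruenceLevel n K 𝔫₀), f ≠ 0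
  swap
  · refine ⟨∅, fun S α _ hα x hx σ hσ => ⟨1, ENNReal.one_ne_top, fun F => ?_⟩⟩
    have hempty : IsEmpty {v : HeightOneSpectrum (𝓞 K) // v ∉ (↑S : Set (HeightOneSpectrum (𝓞 K)))} := by
      refine ⟨fun v => ?_⟩
      obtain ⟨𝔫, h𝔫, -, ϖ, hsat⟩ := hα v.1 v.2
      obtain ⟨-, -, f, hfK, hf0, -⟩ := hsat
      exact hP ⟨𝔫, h𝔫, f, hfK, hf0⟩
    rw [Finset.eq_empty_of_isEmpty F, Finset.prod_empty]
  obtain ⟨𝔫₀, h𝔫₀, f₀, hf₀K, hf₀0⟩ := hP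
  obtain ⟨η, hPη, hη, hηs, hηK, hFne⟩ := hex P h𝔫₀ f₀ hf₀K hf₀0
  have hψ : IsGlobalAddChar K (adeleAddChar K) := isGlobalAddChar_adeleAddChar (K := K)
  have h𝓕 : IsFundamentalDomain ↥(rationalUnipotent n K) (unipotentTateDomain n K) ν :=
    isFundamentalDomain_unipotentTateDomain ν
  have h𝓕c : IsCompact (closure (unipotentTateDomain n K)) := isCompact_closure_unipotentTateDomain
  have h𝓕m : MeasurableSet (unipotentTateDomain n K) := measurableSet_unipotentTateDomain
  haveI := isMulRightInvariant_of_isHaarMeasure_adelicUnipotent ν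
  set φ : GL (Fin n) (AdeleRing (𝓞 K) K) → ℂ :=
    invQuot (AdelicGroupData.gl n K) (smoothedForm η (f₀ : (AdelicGroupData.gl n K).L2 μ)) with hφ
  have hφinv : IsLeftInvariant (AdelicGroupData.gl n K) φ := isLeftInvariant_invQuot _ _
  have hφc : Continuous φ :=
    (continuous_smoothedForm hη hηs _).comp
      ((AdelicGroupData.gl n K).continuous_toAutomorphicQuotient.comp
        (continuous_inv : Continuous fun g : (AdelicGroupData.gl n K).Adelic => g⁻¹))
  set W : GL (Fin n) (AdeleRing (𝓞 K) K) → ℂ :=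
    whittakerCoeff ν (unipotentTateDomain n K) (adeleAddChar K) φ with hW
  have hWc : Continuous W := continuous_whittakerCoeff h𝓕m h𝓕c hψ.continuous hφc
  -- a torus point, integral at every finite place, at which `W` does not vanish
  obtain ⟨g₁, hg₁⟩ := hZ P hPη hη hηs f₀ hFne
  have hWN : ∀ u ∈ upperUnitriangular (Fin n) (AdeleRing (𝓞 K) K), ∀ g, ‖W (u * g)‖ = ‖W g‖ := by
    intro u hu g
    have h := whittakerCoeff_unipotent_mul (ν := ν) (𝓕 := unipotentTateDomain n K) (ψ := adeleAddChar K)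
      h𝓕 hψ hφinv ⟨u, hu⟩ g
    change W (u * g) = _ * W g at h
    rw [h, norm_mul, whittakerCharFun_apply, Circle.norm_coe, one_mul]
  obtain ⟨a₁, k₁, hne₁⟩ := exists_torusPoint_apply_ne_zero hWN hg₁
  obtain ⟨t, -, ht⟩ := exists_principalIdele_mul_valued_snd_le_one a₁
  set a₂ : Fin n → ideleGroup K := fun i => principalIdele K t * a₁ i with ha₂
  have hne₂ : W (torusPoint n K (a₂, k₁)) ≠ 0 := by
    rw [ha₂, torusPoint_principalIdele_mul]
    change whittakerCoeff ν (unipotentTateDomain n K) (adeleAddChar K) φ _ ≠ 0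
    rw [whittakerCoeff_glDiagonal_principalIdele_mul ν _ _ hφinv]
    exact hne₁
  have ha₂int : ∀ i w, Valued.v (((a₂ i : ideleGroup K) : AdeleRing (𝓞 K) K).2 w) ≤ 1 := ht
  -- the exceptional set
  obtain ⟨Sψ, hSψ⟩ := exists_finset_adicComponent_adeleAddChar_unramified (K := K)
  have hTfin := finite_setOf_exists_valued_ne_one a₂
  set S₀ : Finset (HeightOneSpectrum (𝓞 K)) :=
    (Ideal.finite_factors h𝔫₀).toFinset ∪ Sψ ∪ hTfin.toFinset with hS₀
  refine ⟨S₀, fun S α hS hα x hx σ hσ => ?_⟩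
  set Good : Set (HeightOneSpectrum (𝓞 K)) := {w | w ∉ (↑S : Set (HeightOneSpectrum (𝓞 K)))} with hGood
  have hgood : ∀ w ∈ Good, ¬ w.asIdeal ∣ 𝔫₀ ∧ w ∉ Sψ ∧
      ∀ i, Valued.v (((a₂ i : ideleGroup K) : AdeleRing (𝓞 K) K).2 w) = 1 := by
    intro w hw
    have hw0 : w ∉ S₀ := fun h => hw (hS h)
    simp only [hS₀, Finset.mem_union, Set.Finite.mem_toFinset, Set.mem_setOf_eq, not_or,
      not_exists, not_not] at hw0
    exact ⟨hw0.1.1, hw0.1.2, hw0.2⟩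
  have hbox : a₂ ∈ unitBox Good := fun w hw i => (hgood w hw).2.2 i
  have hpos := setLIntegral_torusIntegrand_unitBox_ne_zero hWc hne₂ hbox
    (valued_snd_lastEntry_le_one ha₂int) hΦc hΦpos σ νA νK
  -- the enumerations extended to all places
  set x' : HeightOneSpectrum (𝓞 K) → Fin n → ℂ := fun w =>
    if h : w ∉ (↑S : Set (HeightOneSpectrum (𝓞 K))) then x ⟨w, h⟩ else 0 with hx'def
  have hx' : ∀ (w : HeightOneSpectrum (𝓞 K)) (hw : w ∉ (↑S : Set (HeightOneSpectrum (𝓞 K)))),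
      x' w = x ⟨w, hw⟩ := fun w hw => by simp only [hx'def, dif_pos hw]
  obtain ⟨C, hC, hle⟩ := exists_prod_schurSelfSum_le_of_cuspidal P hα h𝔫₀ hη hηs hηK f₀ h𝓕 h𝓕c hψ
    (Good := Good)
    (fun w hw => ⟨hw, (hgood w hw).1, (hSψ w (hgood w hw).2.1).1, (hSψ w (hgood w hw).2.1).2⟩)
    (x := x') (fun w hw => by rw [hx' w hw]; exact hx ⟨w, hw⟩) Φinf νA νK (hfin P hPη hη hηs f₀ hσ) hpos
  refine ⟨C, hC, fun F => ?_⟩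
  have hsub : (↑(F.map (Function.Embedding.subtype _)) : Set (HeightOneSpectrum (𝓞 K))) ⊆ Good := by
    intro w hw
    rw [Finset.coe_map, Set.mem_image] at hw
    obtain ⟨w', -, rfl⟩ := hw
    exact w'.2
  have h := hle (F.map (Function.Embedding.subtype _)) hsub
  rw [Finset.prod_map] at h
  refine le_trans (le_of_eq (Finset.prod_congr rfl fun w _ => ?_)) h
  rw [Function.Embedding.coe_subtype, hx' w.1 w.2]

/-- **(J) from genericity and the finiteness of the unfolded integral.** Under the hypotheses (hZ)
and (hfin) of `schurSelfSum_ne_top_of_rankinSelberg` for every `σ > 1`, the boundedness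
`JacquetShalika1981_schurSelfSum_prod_bounded` of the partial products `∏_{v ∈ F} T_v(q_v^{-σ})`
off a finite set `S₀(Π)` holds — Jacquet–Shalika's (5.3.3)–(5.3.4) / Lemma (5.2) in the tree's
torus-sum form: with a non-zero `K(𝔫₀)`-fixed `f ∈ Π` (if there is none the statement is vacuous),
a smoothing `φ = invQuot (S_η f)`, Tate's character `ψ` and a torus point `diag(a) k`, `a` integral,
with `W_φ(diag(a) k) ≠ 0` (genericity, Iwasawa, clearing denominators by a rational scalar), take
`S₀ = supp 𝔫₀ ∪ {ψ_v ramified} ∪ {v : a not a unit at v}`; off `S ⊇ S₀` the Euler lower bound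
`exists_prod_schurSelfSum_le_of_cuspidal` applies with `Good = Sᶜ`.
[cite: JacquetShalikaAJM1981, Lemma (5.2), Thm. (5.3) proof, (5.3.3)–(5.3.4)] -/
theorem jacquetShalika1981_schurSelfSum_prod_bounded_of_rankinSelberg
    (ν : Measure ↥(adelicUnipotent n K)) [IsHaarMeasure ν]
    {Φinf : (Fin n → InfiniteAdeleRing K) → ℝ} (hΦc : Continuous Φinf) (hΦpos : ∀ z, 0 < Φinf z)
    (νA : Measure (Fin n → ideleGroup K)) [νA.IsMulLeftInvariant] [SFinite νA] [νA.IsOpenPosMeasure]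
    (νK : Measure ↥(maximalCompactAdelic n K)) [SFinite νK] [νK.IsOpenPosMeasure]
    (hZ : ∀ (P : CuspidalAutomorphicRepGL n K μ) {η : (AdelicGroupData.gl n K).Adelic → ℝ},
      Continuous η → HasCompactSupport η →
      ∀ f : P.1.toSubmodule, smoothedForm η (f : (AdelicGroupData.gl n K).L2 μ) ≠ 0 →
        ∃ g : GL (Fin n) (AdeleRing (𝓞 K) K), whittakerCoeff ν (unipotentTateDomain n K) (adeleAddChar K)
          (invQuot (AdelicGroupData.gl n K) (smoothedForm η (f : (AdelicGroupData.gl n K).L2 μ))) g ≠ 0)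
    (hfin : ∀ (P : CuspidalAutomorphicRepGL n K μ) {η : (AdelicGroupData.gl n K).Adelic → ℝ},
      Continuous η → HasCompactSupport η → ∀ f : P.1.toSubmodule, ∀ ⦃σ : ℝ⦄, 1 < σ →
        rankinSelbergTorusIntegral n K νA νK
          (whittakerCoeff ν (unipotentTateDomain n K) (adeleAddChar K)
            (invQuot (AdelicGroupData.gl n K) (smoothedForm η (f : (AdelicGroupData.gl n K).L2 μ))))
          (standardTestFun n K Φinf) σ ≠ ⊤) :
    JacquetShalika1981_schurSelfSum_prod_bounded (μ := μ) := by
  refine jacquetShalika1981_schurSelfSum_prod_bounded_of_rankinSelberg_of_weights (fun _ => True) ν hΦc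
    hΦpos νA νK (fun P 𝔫 h𝔫 f hfK hf0 => ?_) (fun P _ _ hη hηs f hf => hZ P hη hηs f hf)
    (fun P _ _ hη hηs f σ hσ => hfin P hη hηs f hσ)
  obtain ⟨η, hη, hηs, -, hηK, hne⟩ := exists_weight_smoothedVector_ne_zero (W := P.1)
    (isCompact_principalCongruenceLevel n K h𝔫) hfK hf0
  exact ⟨η, trivial, hη, hηs, hηK, smoothedForm_ne_zero_of_smoothedVector_ne_zero hη hηs hne⟩

/-- **`summable_normSq_trace_satakePow` from genericity and the finiteness of the unfolded
Rankin–Selberg integral.** Under (hZ) (Whittaker coefficients detect the smoothed vectors of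
cuspidal representations: genericity of cusp forms, Shalika / Piatetski-Shapiro) and (hfin) (the
unfolded Rankin–Selberg integral `Ψ(σ; W_φ, W̄_φ, Φ_∞ ⊗ 𝟙_{𝒪̂ⁿ})` of every such coefficient is finite
for `σ > 1`: Jacquet–Shalika (1981), §4), the named fact `summable_normSq_trace_satakePow` of
`AutomorphicLFunctionProofs` — Jacquet–Shalika's (5.3.3)–(5.3.4) off an **arbitrary** set `S` —
holds: it is the conjunction (`summable_normSq_trace_satakePow_iff_schurSelfSum_prod_bounded_and_ne_top`)
of the large-finite-`S` statement (`jacquetShalika1981_schurSelfSum_prod_bounded_of_rankinSelberg`)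
and the finiteness of `T_v(q_v^{-σ})` at every single unramified place
(`schurSelfSum_ne_top_of_rankinSelberg`). [cite: JacquetShalikaAJM1981, Thm. (5.3) proof, (5.3.3)–(5.3.4), (5.1.3)] -/
theorem summable_normSq_trace_satakePow_of_rankinSelberg
    (ν : Measure ↥(adelicUnipotent n K)) [IsHaarMeasure ν]
    {Φinf : (Fin n → InfiniteAdeleRing K) → ℝ} (hΦc : Continuous Φinf) (hΦpos : ∀ z, 0 < Φinf z)
    (νA : Measure (Fin n → ideleGroup K)) [νA.IsMulLeftInvariant] [SFinite νA] [νA.IsOpenPosMeasure]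
    (νK : Measure ↥(maximalCompactAdelic n K)) [SFinite νK] [νK.IsOpenPosMeasure]
    (hZ : ∀ (P : CuspidalAutomorphicRepGL n K μ) {η : (AdelicGroupData.gl n K).Adelic → ℝ},
      Continuous η → HasCompactSupport η →
      ∀ f : P.1.toSubmodule, smoothedForm η (f : (AdelicGroupData.gl n K).L2 μ) ≠ 0 →
        ∃ g : GL (Fin n) (AdeleRing (𝓞 K) K), whittakerCoeff ν (unipotentTateDomain n K) (adeleAddChar K)
          (invQuot (AdelicGroupData.gl n K) (smoothedForm η (f : (AdelicGroupData.gl n K).L2 μ))) g ≠ 0)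
    (hfin : ∀ (P : CuspidalAutomorphicRepGL n K μ) {η : (AdelicGroupData.gl n K).Adelic → ℝ},
      Continuous η → HasCompactSupport η → ∀ f : P.1.toSubmodule, ∀ ⦃σ : ℝ⦄, 1 < σ →
        rankinSelbergTorusIntegral n K νA νK
          (whittakerCoeff ν (unipotentTateDomain n K) (adeleAddChar K)
            (invQuot (AdelicGroupData.gl n K) (smoothedForm η (f : (AdelicGroupData.gl n K).L2 μ))))
          (standardTestFun n K Φinf) σ ≠ ⊤) :
    summable_normSq_trace_satakePow (μ := μ) :=
  summable_normSq_trace_satakePow_iff_schurSelfSum_prod_bounded_and_ne_top.2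
    ⟨jacquetShalika1981_schurSelfSum_prod_bounded_of_rankinSelberg ν hΦc hΦpos νA νK hZ hfin,
      fun P _ _ hα _ hv _ hx _ hσ => schurSelfSum_ne_top_of_rankinSelberg P hα hv hx ν hΦc hΦpos νA νK
        (fun hη hηs f hf => hZ P hη hηs f hf) (fun hη hηs f => hfin P hη hηs f hσ)⟩

/-- Hence also **Jacquet–Shalika's bound (5.1.3)** `|μ_{j,v}| ≤ q_v^{1/2}` at every unramified place
(`norm_satakeParameter_le_sqrt`) under the same two hypotheses
(`norm_satakeParameter_le_sqrt_of_summable`). [cite: JacquetShalikaAJM1981, (5.1.3) p. 554] -/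
theorem norm_satakeParameter_le_sqrt_of_rankinSelberg
    (ν : Measure ↥(adelicUnipotent n K)) [IsHaarMeasure ν]
    {Φinf : (Fin n → InfiniteAdeleRing K) → ℝ} (hΦc : Continuous Φinf) (hΦpos : ∀ z, 0 < Φinf z)
    (νA : Measure (Fin n → ideleGroup K)) [νA.IsMulLeftInvariant] [SFinite νA] [νA.IsOpenPosMeasure]
    (νK : Measure ↥(maximalCompactAdelic n K)) [SFinite νK] [νK.IsOpenPosMeasure]
    (hZ : ∀ (P : CuspidalAutomorphicRepGL n K μ) {η : (AdelicGroupData.gl n K).Adelic → ℝ},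
      Continuous η → HasCompactSupport η →
      ∀ f : P.1.toSubmodule, smoothedForm η (f : (AdelicGroupData.gl n K).L2 μ) ≠ 0 →
        ∃ g : GL (Fin n) (AdeleRing (𝓞 K) K), whittakerCoeff ν (unipotentTateDomain n K) (adeleAddChar K)
          (invQuot (AdelicGroupData.gl n K) (smoothedForm η (f : (AdelicGroupData.gl n K).L2 μ))) g ≠ 0)
    (hfin : ∀ (P : CuspidalAutomorphicRepGL n K μ) {η : (AdelicGroupData.gl n K).Adelic → ℝ},
      Continuous η → HasCompactSupport η → ∀ f : P.1.toSubmodule, ∀ ⦃σ : ℝ⦄, 1 < σ →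
        rankinSelbergTorusIntegral n K νA νK
          (whittakerCoeff ν (unipotentTateDomain n K) (adeleAddChar K)
            (invQuot (AdelicGroupData.gl n K) (smoothedForm η (f : (AdelicGroupData.gl n K).L2 μ))))
          (standardTestFun n K Φinf) σ ≠ ⊤) :
    norm_satakeParameter_le_sqrt (μ := μ) :=
  norm_satakeParameter_le_sqrt_of_summable
    (summable_normSq_trace_satakePow_of_rankinSelberg ν hΦc hΦpos νA νK hZ hfin)

end Cuspidal

end Literature.NumberTheory.Automorphic
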